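import Mathlib
import Literature.MathematicalPhysics.QuantumFieldTheory.Balaban1983to89.B11B3
import Literature.MathematicalPhysics.QuantumFieldTheory.Balaban1983to89.B6Lemma21Repaired

/-!
# `Balaban1983to89.B11B3Repaired` — the constant B₃ of (162) in B11 bound from Lemma 2.1 of [3] in its PARAMETER /
REPAIRED form, a closed-form majorant B₃ ≤ B₃⁺(d, L, δ₀, B₀), and the located largeness G-pv21-1 as an R₁M₁-floor

T. Bałaban, *The variational problem and background fields in renormalization group method for lattice gauge
theories*, Commun. Math. Phys. **102**, 277–309 (1985) [Balaban1985Variational] (cell paper B11; PDF held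
`paper:balaban1985-cmp102-variational-background`, journal page = PDF page + 276).  Sibling LEAF of `…Balaban1983to89.B11B3`
(unit b2b-balaban-pv21; UNTOUCHED — its `sum162`, `Claim162`, `sum162_le`, `dist_lower_of_ineq260`, `smallness_of_log` are
reused BY NAME) and of `…B6Lemma21Repaired` (`Ineq261With c`, `Lemma21Repaired`, constant `B6Lemma21Arith.c1Repaired`;
UNTOUCHED).  Nothing in the tree is modified; no new analytic content — packaging only.

CITATION HEADER (lean-in-tree rule 2026-08-18).  This module is a KERNEL-CHECKED BOOKKEEPING STEP of the published paper
[Balaban1985Variational], p. 303 [PDF 27], verbatim: *"Let us take B₃ = 72d³L³B₀ sup_{ℭ_k} sup_{y₁} Σ_{y₂∈ℭ_k}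
e^{−1/2δ₀d(y₁,y₂)}(d(y₁,y₂) + 1)(L^{j₂}η)^{−1}. (162)  It follows from the inequalities (2.47)–(2.51) of [3] that B₃ depends
on d and L only."*, where [3] = [Balaban1984PropagatorsII] and the finite-sum statement fed by its (2.47)–(2.51) is Lemma 2.1,
p. 234 [PDF 12], verbatim: *"For the numbers α, 0 < α < 1, c₁(α) = 12c₀^d(½α), and RM satisfying (2.59) we have
e^{−αδ₀d(y,y′)} ≦ e^{−αδ₀RM max{|j−j′|−1,0}}, y ∈ Λ_j, y′ ∈ Λ_{j′}, (2.60)  sup_{y∈𝔅} Σ_{y′∈𝔅} e^{−αδ₀d(y,y′)} ≦ c₁(α), (2.61)"*,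
with (2.59) p. 233 [PDF 11] verbatim *"Now we require that RM is sufficiently large, i.e. we assume ¼αδ₀RM > 2d log c₀(½α) + 1. (2.59)"*
and *"c₀(α) = Σ_{z∈Z} e^{−αδ₀|z|}"* (same page).  Renders read as images by this unit: `b2b-balaban-ref1/pages/1984-cmp96-propagators-rt-II/
…-p011-x2.png`, `…-p012-x2.png` (pp. 233–234); B11 p. 303 = the b11 lineage's render-checked transcript `b2b-balaban-b11/transcript.md`
(quotation side of (161)–(162) also certified word by word in cell row C-pv10-10).

WHY THIS LEAF (cell rows G-B11-F2, C-pv21-1, G-pv21-1, G-ref1-11, G-A11-1, G-A12-1).  `B11B3.sum162_le` (pv21) is the kernel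
of "B₃ depends on d and L only" and is GENERIC in the (2.61)-constant; but its packaged corollaries `B11B3.sum162_le_of_lemma21`
/ `B11B3.claim162_of_lemma21` take the VERBATIM printed Lemma 2.1, `B6.Lemma21Printed` (c₁(α) = 12c₀(½α)^d), as hypothesis —
and that constant is exceeded for d ≥ 3 on the slab-witness geometries (kernel `B6Lemma21Counterexample.printed_c1_exceeded`,
cell row G-A11-1), so in d = 4 those corollaries may run through a refuted-as-typed hypothesis (cell row G-ref1-11: "per-consumer
audit").  Here the same conclusion is packaged (i) in the PARAMETER shape — (2.60) ∧ (2.61) with ANY constant c (`Ineq261With c`,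
the shape `DagBinding.B6Lemma21Param` binds; restated locally as `Lemma21Param` to keep the import cone at two leaves) — and
(ii) from the REPAIRED statement `B6Lemma21Repaired.Lemma21Repaired` (c₁′(α) = 13c₀(½α)^{3d}, cell row G-A12-1), giving the
closed form B₃ ≤ B₃⁺ := 72d³L³B₀·L²(8/(eδ₀) + 1)·13c₀(1/16)^{3d} (`B3Upper`, `B3_le_B3Upper`; scale allowance g ≤ 2 of the
observation point y₁ ∈ Δ ⊂ □, Sect. F p. 303).  (iii) The located largeness of cell row G-pv21-1 (not displayed in print:
`log L ≤ ¼δ₀R₁M₁` and (2.59) of [3] at α = ⅛) is unpacked as an explicit FLOOR on R₁M₁ for the cell's finite-torus bookkeeping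
(T⁴ rows G-ne3p2-7 / Caveat C2): `cond259_eighth_iff` ((2.59)@⅛ ⟺ 32(2d·log c₀(1/16) + 1) < δ₀R₁M₁), `log_le_quarter_iff`,
`located_largeness_of_floor` (any F with 4·log L ≤ δ₀F, 32(2d·log c₀(1/16) + 1) < δ₀F and F ≤ R₁M₁ delivers both binders).

WHAT IS REPRODUCED (0 sorry): `sum_le_of_ineq261With`; `sum162_le_of_ineq260_261With` (one situation: (2.60) + (2.61)-with-c
at α = ⅛ + L ≥ 1, η > 0, L^kη ≥ 1, RM ≥ 0, scales ≤ k, d ≥ 0, log L ≤ ¼δ₀RM ⟹ Σ_{y₂∈ℭ} e^{−½δ₀d}(d+1)(L^{j₂}η)^{−1} ≤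
L^g(8/(eδ₀) + 1)·c); `Lemma21Param` + `lemma21Param_of_repaired` + `lemma21Param_of_printed` (direction of the constants only);
`claim162_of_lemma21Param`; `sum162_le_of_lemma21Repaired`; `claim162_of_lemma21Repaired`; `c1Repaired_eighth`; `B3Upper`,
`B3Upper_nonneg`, `B3_le_B3Upper`; the floor lemmas (iii).
WHAT IS NOT REPRODUCED (hypotheses, each named — none is a cited fact): Lemma 2.1 of [3] in any form (printed / parameter /
repaired: HYPOTHESES; the repaired statement is itself reduced in the tree to (2.60) [kernel, `B6Geometry.ineq260_of_levelGap`]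
plus the one analytic leaf (2.61′) `Ineq261With (c1Repaired …)`, `B6Lemma21Repaired.lemma21Repaired_of_ineq261R`); the chain
(161) and (163)–(164) (`…B11`, cell row C-B11-F1); the geometric dictionary of `B11B3` (cell row D-pv21.1); the value of δ₀
and B₀ ([3] Prop. 2.1/2.2, [Balaban1984PropagatorsI]: functions of (d, L), hypotheses wherever used).  NOTHING of the series'
end-statement (ultraviolet stability, [Balaban1987RG1] Thm 2 ff., under adjudication by the cell `pub-balaban`) is asserted;
value = kernel-checked bookkeeping of a printed "it follows from … of [3]" in the consumers' hypothesis shape + an explicit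
majorant and floor, NOT summit progress.  Unit `b2b-balaban-b11-g17` (paper sub-cell B11, gen 17), cell claim
G-B11-F2-REPAIRED-C1; cell rows C-B11-G17a (this leaf), G-B11-F2 (UPDATE), G-pv21-1, G-ref1-11.
-/

namespace Literature.MathematicalPhysics.QuantumFieldTheory.Balaban1983to89.B11B3Repaired

open Literature.MathematicalPhysics.QuantumFieldTheory.Balaban1983to89
open Finset

/-! ## (162) from (2.60) + (2.61) with a GENERIC constant -/

/-- (2.61) with a generic constant `c` (`B6Lemma21Repaired.Ineq261With c`: the full row sum over 𝔅 is ≤ c; the terms are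
positive) ⇒ the row sum over any finite ℭ ⊆ 𝔅 is ≤ c. [cite: Balaban1984PropagatorsII, (2.61) p.234] -/
theorem sum_le_of_ineq261With (g : B6.Geometry) (δ₀ α c : ℝ) (h261 : B6Lemma21Repaired.Ineq261With c g δ₀ α)
    (C : Finset g.Site) (y₁ : g.Site) :
    ∑ y₂ ∈ C, Real.exp (-(α * δ₀ * g.dist y₁ y₂)) ≤ c :=
  (Finset.sum_le_sum_of_subset_of_nonneg (Finset.subset_univ C)
    (fun _ _ _ => (Real.exp_pos _).le)).trans (h261 y₁)

/-- **(162) bounded from (2.60) + (2.61)-with-any-constant at α = ⅛** (split (a,b,c) = (¼,⅛,⅛) of the rate ½δ₀, as in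
`B11B3.sum162_le_of_lemma21`, but with the (2.61)-constant a PARAMETER `c`): for one situation (k; ℭ_k) with L ≥ 1, η > 0,
L^kη ≥ 1 ((5) p. 278: η = L^{−k}), RM ≥ 0, scales ≤ k, d ≥ 0, the located largeness `log L ≤ ¼δ₀RM` (cell row G-pv21-1), an
observation point y₁ of scale allowance `gap` (y₁ ∈ Δ ⊂ □: gap ≤ 2) and every finite ℭ:
`Σ_{y₂∈ℭ} e^{−½δ₀d}(d + 1)(L^{j₂}η)^{−1} ≤ L^{gap}·(8/(eδ₀) + 1)·c`.
[cite: Balaban1985Variational, (162) p.303; Balaban1984PropagatorsII, Lemma 2.1 (2.60)–(2.61) p.234] -/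
theorem sum162_le_of_ineq260_261With (g : B6.Geometry) (δ₀ c : ℝ) (hδ₀ : 0 < δ₀) (gap : ℕ)
    (h260 : B6RandomWalk.Ineq260 g δ₀ (1 / 8)) (h261 : B6Lemma21Repaired.Ineq261With c g δ₀ (1 / 8))
    (hL : 1 ≤ g.L) (heta : 0 < g.eta) (hnorm : 1 ≤ g.L ^ g.k * g.eta) (hRM : 0 ≤ g.R * g.M)
    (hlog : Real.log g.L ≤ 1 / 4 * δ₀ * (g.R * g.M))
    (hscale : ∀ y, g.scale y ≤ g.k) (hdist : ∀ y y', 0 ≤ g.dist y y')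
    (y₁ : g.Site) (hy₁ : (g.k : ℝ) - g.scale y₁ ≤ (gap : ℝ) - 1) (C : Finset g.Site) :
    B11B3.sum162 g δ₀ C y₁ ≤ g.L ^ gap * (8 / (Real.exp 1 * δ₀) + 1) * c := by
  have h18 : (0 : ℝ) < 1 / 8 := by norm_num
  have hL0 : 0 < g.L := by linarith
  have hmain := B11B3.sum162_le g δ₀ (1 / 4) (1 / 8) (1 / 8) c gap C y₁ hδ₀
    (by norm_num) h18 h18.le (by norm_num) hL heta hnorm (fun y₂ _ => hscale y₂) (fun y₂ _ => hdist y₁ y₂)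
    (fun y₂ _ => B11B3.dist_lower_of_ineq260 g δ₀ (1 / 8) (by positivity) hRM h260 gap y₁ y₂ hy₁ (hscale y₂))
    (sum_le_of_ineq261With g δ₀ (1 / 8) c h261 C y₁) (B11B3.smallness_of_log hL0 hlog)
  have hconst : 1 / (Real.exp 1 * (1 / 8 * δ₀)) = 8 / (Real.exp 1 * δ₀) := by
    have he : Real.exp 1 ≠ 0 := (Real.exp_pos 1).ne'
    field_simp
  rw [hconst] at hmain
  exact hmain

/-! ## Lemma 2.1 of [3] in PARAMETER form and in REPAIRED form as hypotheses -/

/-- Lemma 2.1 of [3] in PARAMETER form for a family of geometries: there is a constant function c₁(·) such that, for every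
member satisfying (2.1)–(2.2), every 0 < α < 1 and RM with (2.59), (2.60) and (2.61)-with-constant-c₁(α) hold.  This is
`DagBinding.B6Lemma21Param` with its `BlockData` wrapper unfolded (not imported here: import cone kept at two leaves); the shape
all consumers of (2.61) use (c₁ only as an α-dependent O(1)).  A Prop, NOT asserted.
[cite: Balaban1984PropagatorsII, Lemma 2.1 p.234] -/
def Lemma21Param {I : Type} (d : ℕ) (δ₀ : ℝ) (geo : I → B6.Geometry) : Prop :=
  ∃ c₁ : ℝ → ℝ, ∀ i : I, (geo i).Hyp21_22 → ∀ α : ℝ, 0 < α → α < 1 →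
    B6.Cond259 d δ₀ α (geo i).R (geo i).M →
      B6RandomWalk.Ineq260 (geo i) δ₀ α ∧ B6Lemma21Repaired.Ineq261With (c₁ α) (geo i) δ₀ α

/-- The REPAIRED Lemma 2.1 (`B6Lemma21Repaired.Lemma21Repaired`, c₁′(α) = 13c₀(½α)^{3d}, cell row G-A12-1) is an instance of
the parameter form, with c₁ := c₁′. [folklore] -/
theorem lemma21Param_of_repaired {I : Type} (d : ℕ) (δ₀ : ℝ) (geo : I → B6.Geometry)
    (h : B6Lemma21Repaired.Lemma21Repaired d δ₀ geo) : Lemma21Param d δ₀ geo :=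
  ⟨fun α => B6Lemma21Arith.c1Repaired d δ₀ α, h⟩

/-- Direction of the constants only: the VERBATIM printed Lemma 2.1 (`B6.Lemma21Printed`, c₁ = 12c₀(½α)^d) would also be an
instance — recorded for bookkeeping; the antecedent is refuted-as-typed for d ≥ 3 on the slab-witness geometries (cell row
G-A11-1), so this is the settled negative edge, not a usable input. [folklore] -/
theorem lemma21Param_of_printed {I : Type} (d : ℕ) (δ₀ : ℝ) (hδ : 0 < δ₀) (geo : I → B6.Geometry)
    (h : B6.Lemma21Printed d δ₀ geo) : Lemma21Param d δ₀ geo :=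
  lemma21Param_of_repaired d δ₀ geo (B6Lemma21Repaired.lemma21Printed_imp_repaired d δ₀ hδ geo h)

/-- **`B11B3.Claim162` from Lemma 2.1 in PARAMETER form** — "B₃ depends on d and L only" in the consumers' hypothesis shape:
for a family of situations with common (d, L, δ₀) satisfying, member by member, (2.1)–(2.2), (2.59) at α = ⅛, η > 0, L^kη ≥ 1,
RM ≥ 0, scales ≤ k, d ≥ 0 and the located largeness `log L ≤ ¼δ₀RM` (cell row G-pv21-1), the double supremum of (162) over
observation points of scale allowance `gap` is ≤ S := L^{gap}(8/(eδ₀) + 1)·c₁(⅛).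
[cite: Balaban1985Variational, (162) p.303; Balaban1984PropagatorsII, Lemma 2.1 p.234] -/
theorem claim162_of_lemma21Param {I : Type} (d : ℕ) (δ₀ L : ℝ) (gap : ℕ) (geo : I → B6.Geometry)
    (h21 : Lemma21Param d δ₀ geo) (hδ₀ : 0 < δ₀) (hL : 1 ≤ L)
    (hgeo : ∀ i, (geo i).Hyp21_22 ∧ (geo i).L = L ∧ 0 < (geo i).eta ∧
      1 ≤ (geo i).L ^ (geo i).k * (geo i).eta ∧ 0 ≤ (geo i).R * (geo i).M ∧
      B6.Cond259 d δ₀ (1 / 8) (geo i).R (geo i).M ∧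
      Real.log L ≤ 1 / 4 * δ₀ * ((geo i).R * (geo i).M) ∧
      (∀ y, (geo i).scale y ≤ (geo i).k) ∧ (∀ y y', 0 ≤ (geo i).dist y y')) :
    B11B3.Claim162 δ₀ geo (fun i y₁ => ((geo i).k : ℝ) - (geo i).scale y₁ ≤ (gap : ℝ) - 1) := by
  obtain ⟨c₁, h⟩ := h21
  refine ⟨L ^ gap * (8 / (Real.exp 1 * δ₀) + 1) * c₁ (1 / 8), fun i y₁ hy₁ C => ?_⟩
  obtain ⟨hH, hLi, heta, hnorm, hRM, h259, hlog, hscale, hdist⟩ := hgeo i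
  obtain ⟨h260, h261⟩ := h i hH (1 / 8) (by norm_num) (by norm_num) h259
  have hL' : 1 ≤ (geo i).L := by rw [hLi]; exact hL
  have hlog' : Real.log (geo i).L ≤ 1 / 4 * δ₀ * ((geo i).R * (geo i).M) := by rw [hLi]; exact hlog
  have hb := sum162_le_of_ineq260_261With (geo i) δ₀ (c₁ (1 / 8)) hδ₀ gap h260 h261 hL' heta hnorm hRM
    hlog' hscale hdist y₁ hy₁ C
  rw [hLi] at hb
  exact hb

/-- **(162) bounded from the REPAIRED Lemma 2.1** (hypothesis `B6Lemma21Repaired.Lemma21Repaired d δ₀ geo`, used at α = ⅛):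
for a situation `i` with (2.1)–(2.2), (2.59) at α = ⅛, L ≥ 1, η > 0, L^kη ≥ 1, RM ≥ 0, scales ≤ k, d ≥ 0 and `log L ≤ ¼δ₀RM`
(cell row G-pv21-1), every observation point of scale allowance `gap` and every finite ℭ:
`Σ_{y₂∈ℭ} e^{−½δ₀d}(d+1)(L^{j₂}η)^{−1} ≤ L^{gap}(8/(eδ₀) + 1)·c₁′(⅛)`, c₁′(⅛) = 13c₀(1/16)^{3d} (`c1Repaired_eighth`).
[cite: Balaban1985Variational, (162) p.303; Balaban1984PropagatorsII, Lemma 2.1 p.234] -/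
theorem sum162_le_of_lemma21Repaired {I : Type} (d : ℕ) (δ₀ : ℝ) (geo : I → B6.Geometry)
    (h21 : B6Lemma21Repaired.Lemma21Repaired d δ₀ geo) (hδ₀ : 0 < δ₀) (gap : ℕ) (i : I)
    (hH : (geo i).Hyp21_22) (h259 : B6.Cond259 d δ₀ (1 / 8) (geo i).R (geo i).M)
    (hL : 1 ≤ (geo i).L) (heta : 0 < (geo i).eta) (hnorm : 1 ≤ (geo i).L ^ (geo i).k * (geo i).eta)
    (hRM : 0 ≤ (geo i).R * (geo i).M)
    (hlog : Real.log (geo i).L ≤ 1 / 4 * δ₀ * ((geo i).R * (geo i).M))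
    (hscale : ∀ y, (geo i).scale y ≤ (geo i).k) (hdist : ∀ y y', 0 ≤ (geo i).dist y y')
    (y₁ : (geo i).Site) (hy₁ : ((geo i).k : ℝ) - (geo i).scale y₁ ≤ (gap : ℝ) - 1)
    (C : Finset (geo i).Site) :
    B11B3.sum162 (geo i) δ₀ C y₁ ≤
      (geo i).L ^ gap * (8 / (Real.exp 1 * δ₀) + 1) * B6Lemma21Arith.c1Repaired d δ₀ (1 / 8) := by
  obtain ⟨h260, h261⟩ := h21 i hH (1 / 8) (by norm_num) (by norm_num) h259
  exact sum162_le_of_ineq260_261With (geo i) δ₀ _ hδ₀ gap h260 h261 hL heta hnorm hRM hlog hscale hdist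
    y₁ hy₁ C

/-- **`B11B3.Claim162` from the REPAIRED Lemma 2.1** (family version; S = L^{gap}(8/(eδ₀) + 1)·13c₀(1/16)^{3d}).
[cite: Balaban1985Variational, (162) p.303; Balaban1984PropagatorsII, Lemma 2.1 p.234] -/
theorem claim162_of_lemma21Repaired {I : Type} (d : ℕ) (δ₀ L : ℝ) (gap : ℕ) (geo : I → B6.Geometry)
    (h21 : B6Lemma21Repaired.Lemma21Repaired d δ₀ geo) (hδ₀ : 0 < δ₀) (hL : 1 ≤ L)
    (hgeo : ∀ i, (geo i).Hyp21_22 ∧ (geo i).L = L ∧ 0 < (geo i).eta ∧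
      1 ≤ (geo i).L ^ (geo i).k * (geo i).eta ∧ 0 ≤ (geo i).R * (geo i).M ∧
      B6.Cond259 d δ₀ (1 / 8) (geo i).R (geo i).M ∧
      Real.log L ≤ 1 / 4 * δ₀ * ((geo i).R * (geo i).M) ∧
      (∀ y, (geo i).scale y ≤ (geo i).k) ∧ (∀ y y', 0 ≤ (geo i).dist y y')) :
    B11B3.Claim162 δ₀ geo (fun i y₁ => ((geo i).k : ℝ) - (geo i).scale y₁ ≤ (gap : ℝ) - 1) :=
  claim162_of_lemma21Param d δ₀ L gap geo (lemma21Param_of_repaired d δ₀ geo h21) hδ₀ hL hgeo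

/-! ## The closed-form majorant B₃ ≤ B₃⁺(d, L, δ₀, B₀) -/

/-- c₁′(⅛) = 13c₀(1/16)^{3d} (`B6Lemma21Arith.c1Repaired d δ₀ α = 13c₀(½α)^{3d}` at α = ⅛). [folklore] -/
theorem c1Repaired_eighth (d : ℕ) (δ₀ : ℝ) :
    B6Lemma21Arith.c1Repaired d δ₀ (1 / 8) = 13 * B6.c0 δ₀ (1 / 16) ^ (3 * d) := by
  simp only [B6Lemma21Arith.c1Repaired]
  norm_num

/-- **B₃⁺(d, L, δ₀, B₀) := 72d³L³B₀ · L²(8/(eδ₀) + 1)·13c₀(1/16)^{3d}** — the explicit majorant of B₃ = (162) obtained from the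
repaired Lemma 2.1 at α = ⅛ with the scale allowance g ≤ 2 of the observation point (y₁ ∈ Δ ⊂ □ at scale k or k − 1 of
{Ω′_j}, Sect. F p. 303) and the located largeness of cell row G-pv21-1; a function of (d, L, δ₀, B₀) only — hence of (d, L)
once δ₀ = δ₀(d, L), B₀ = B₀(d, L) ([3] Prop. 2.1/2.2) are fixed, which is the printed "B₃ depends on d and L only".
[cite: Balaban1985Variational, (162) p.303] -/
noncomputable def B3Upper (d : ℕ) (L δ₀ B₀ : ℝ) : ℝ :=
  72 * (d : ℝ) ^ 3 * L ^ 3 * B₀ * (L ^ 2 * (8 / (Real.exp 1 * δ₀) + 1) * (13 * B6.c0 δ₀ (1 / 16) ^ (3 * d)))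

/-- B₃⁺ ≥ 0 for L ≥ 0, δ₀ > 0, B₀ ≥ 0 (c₀ ≥ 0 as a sum of exponentials). [folklore] -/
theorem B3Upper_nonneg (d : ℕ) {L δ₀ B₀ : ℝ} (hL : 0 ≤ L) (hδ₀ : 0 < δ₀) (hB₀ : 0 ≤ B₀) :
    0 ≤ B3Upper d L δ₀ B₀ := by
  have hc : 0 ≤ 13 * B6.c0 δ₀ (1 / 16) ^ (3 * d) := by
    rw [← c1Repaired_eighth]; exact B6Lemma21Repaired.c1Repaired_nonneg d δ₀ (1 / 8)
  unfold B3Upper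
  positivity

/-- **B₃ ≤ B₃⁺**: for every situation `i` of a family with common L satisfying the hypotheses of
`sum162_le_of_lemma21Repaired`, every observation point of scale allowance `gap ≤ 2`, every finite ℭ and every B₀ ≥ 0,
`72d³L³B₀ · Σ_{y₂∈ℭ} e^{−½δ₀d(y₁,y₂)}(d(y₁,y₂) + 1)(L^{j₂}η)^{−1} ≤ B₃⁺(d, L, δ₀, B₀)` — so the supremum (162) is
≤ B₃⁺, uniformly in k, ℭ_k, y₁. [cite: Balaban1985Variational, (162) p.303; Balaban1984PropagatorsII, Lemma 2.1 p.234] -/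
theorem B3_le_B3Upper {I : Type} (d : ℕ) (δ₀ L B₀ : ℝ) (geo : I → B6.Geometry)
    (h21 : B6Lemma21Repaired.Lemma21Repaired d δ₀ geo) (hδ₀ : 0 < δ₀) (hL : 1 ≤ L) (hB₀ : 0 ≤ B₀)
    (gap : ℕ) (hgap : gap ≤ 2) (i : I)
    (hH : (geo i).Hyp21_22) (hLi : (geo i).L = L) (h259 : B6.Cond259 d δ₀ (1 / 8) (geo i).R (geo i).M)
    (heta : 0 < (geo i).eta) (hnorm : 1 ≤ (geo i).L ^ (geo i).k * (geo i).eta) (hRM : 0 ≤ (geo i).R * (geo i).M)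
    (hlog : Real.log L ≤ 1 / 4 * δ₀ * ((geo i).R * (geo i).M))
    (hscale : ∀ y, (geo i).scale y ≤ (geo i).k) (hdist : ∀ y y', 0 ≤ (geo i).dist y y')
    (y₁ : (geo i).Site) (hy₁ : ((geo i).k : ℝ) - (geo i).scale y₁ ≤ (gap : ℝ) - 1)
    (C : Finset (geo i).Site) :
    72 * (d : ℝ) ^ 3 * L ^ 3 * B₀ * B11B3.sum162 (geo i) δ₀ C y₁ ≤ B3Upper d L δ₀ B₀ := by
  have hL' : 1 ≤ (geo i).L := by rw [hLi]; exact hL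
  have hlog' : Real.log (geo i).L ≤ 1 / 4 * δ₀ * ((geo i).R * (geo i).M) := by rw [hLi]; exact hlog
  have hs := sum162_le_of_lemma21Repaired d δ₀ geo h21 hδ₀ gap i hH h259 hL' heta hnorm hRM hlog' hscale hdist
    y₁ hy₁ C
  rw [hLi, c1Repaired_eighth] at hs
  have hc : 0 ≤ 13 * B6.c0 δ₀ (1 / 16) ^ (3 * d) := by
    rw [← c1Repaired_eighth]; exact B6Lemma21Repaired.c1Repaired_nonneg d δ₀ (1 / 8)
  have hK : 0 ≤ 8 / (Real.exp 1 * δ₀) + 1 := by positivity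
  have hLg : L ^ gap ≤ L ^ 2 := pow_le_pow_right₀ hL hgap
  have hs2 : B11B3.sum162 (geo i) δ₀ C y₁ ≤
      L ^ 2 * (8 / (Real.exp 1 * δ₀) + 1) * (13 * B6.c0 δ₀ (1 / 16) ^ (3 * d)) :=
    hs.trans (mul_le_mul_of_nonneg_right (mul_le_mul_of_nonneg_right hLg hK) hc)
  unfold B3Upper
  exact mul_le_mul_of_nonneg_left hs2 (by positivity)

/-! ## The located largeness G-pv21-1 as an explicit floor on R₁M₁ -/

/-- (2.59) of [3] at α = ⅛, unpacked: `¼·⅛·δ₀RM > 2d log c₀(1/16) + 1 ⟺ 32(2d·log c₀(1/16) + 1) < δ₀·RM`.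
[cite: Balaban1984PropagatorsII, (2.59) p.233] -/
theorem cond259_eighth_iff (d : ℕ) (δ₀ R M : ℝ) :
    B6.Cond259 d δ₀ (1 / 8) R M ↔ 32 * (2 * d * Real.log (B6.c0 δ₀ (1 / 16)) + 1) < δ₀ * (R * M) := by
  unfold B6.Cond259
  norm_num
  constructor <;> intro h <;> linarith

/-- The located largeness `log L ≤ ¼δ₀RM` of cell row G-pv21-1 in floor form: `4·log L ≤ δ₀·RM`. [folklore] -/
theorem log_le_quarter_iff (δ₀ L R M : ℝ) :
    Real.log L ≤ 1 / 4 * δ₀ * (R * M) ↔ 4 * Real.log L ≤ δ₀ * (R * M) := by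
  constructor <;> intro h <;> linarith

/-- **The R₁M₁-floor.**  Any number F with `4·log L ≤ δ₀F` and `32(2d·log c₀(1/16) + 1) < δ₀F` is a floor: R₁M₁ ≥ F delivers
BOTH located binders of `sum162_le_of_lemma21Repaired` / `claim162_of_lemma21Repaired` / `B3_le_B3Upper` — the largeness
`log L ≤ ¼δ₀R₁M₁` (cell row G-pv21-1; by `B11B3.divergence_witness` a relation of this kind, ½δ₀R₁M₁ > log L, is NECESSARY for a
k-uniform B₃) and (2.59) of [3] at α = ⅛.  This is the form in which "taking R₁M₁ larger if necessary, depending on (d, L)"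
enters a finite-torus side condition (cube class of Thm 1 non-empty). [cite: Balaban1984PropagatorsII, (2.59) p.233] -/
theorem located_largeness_of_floor (d : ℕ) (δ₀ L R M F : ℝ) (hδ₀ : 0 < δ₀)
    (hF1 : 4 * Real.log L ≤ δ₀ * F) (hF2 : 32 * (2 * d * Real.log (B6.c0 δ₀ (1 / 16)) + 1) < δ₀ * F)
    (hRM : F ≤ R * M) :
    Real.log L ≤ 1 / 4 * δ₀ * (R * M) ∧ B6.Cond259 d δ₀ (1 / 8) R M := by
  have h1 : δ₀ * F ≤ δ₀ * (R * M) := mul_le_mul_of_nonneg_left hRM hδ₀.le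
  exact ⟨by linarith, (cond259_eighth_iff d δ₀ R M).mpr (by linarith)⟩

end Literature.MathematicalPhysics.QuantumFieldTheory.Balaban1983to89.B11B3Repaired
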